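import Summits.ABC.ABC.Theses.TwistAmplification
import Literature.NumberTheory.EllipticCurves.SzpiroLocalDataProofs
import Literature.NumberTheory.EllipticCurves.SzpiroFreyProofs

/-!
# `ModerateWindowCount` (stmt-ABC-1973) — negative-side lemmas II: the twisted Frey family `tf α k`

Standing-adversary (cdisprove) output. The family behind the sharpness of `6 < σ`: fix an odd prime `p`,
`j = 4i`, `q = p^j = 16k + 1`; for a prime `d ≥ 5`, `d ≠ p`, `d ∤ k` and `D = 4α − 1 = ±d`, the Frey curve
`y² = x(x − A)(x + B)`, `A = D`, `B = 16Dk = D(q−1)`, `A + B = Dq` (the quadratic twist by `D` of the Frey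
curve of `1 + (q−1) = q`) has the Serre-normalised model `⟨1, (B−A−1)/4, 0, −AB/16, 0⟩` (Bombieri–Gubler
(12.18)); translating by `[1, r, 0, t]` gives the REDUCED model `tf α k` (`a₁ = 1`, `a₂ ∈ {−1,0,1}`,
`a₃ ∈ {0,1}`), written out polynomially (`fm`). Certified here:
* invariants `c₄ = D² m` (`m = 256k² + 16k + 1 = 16kq + 1`), `Δ = D⁶ k² q²`, `c₆ = −D³(16k−1)(8k+1)(32k+1)`;
* `eq_d_of_dvd_Δ_of_dvd_c₄`: a prime dividing `Δ` and `c₄` is `d`; `d¹² ∤ Δ`; hence minimality at every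
  place (`isMinimalAt_baseChange_int_of_not_dvd_c₄` / `_of_not_pow_dvd_Δ`);
* `tf_conductorExponent`: `f_d = 2` (additive, `d ≥ 5`), `f_p = 1`, `f_ℓ = 1` for `ℓ ∣ k` (multiplicative),
  `0` elsewhere (B–G 12.5.9 via `SzpiroLocalDataProofs`), and `tf_conductorNorm`: **`N = d² · p · rad k`**.
Refuter seat refuter-cdisprove-stmt-ABC-1973-0, 2026-08-16.
-/

namespace Summit.ABC.ABC.Theorems.ModerateWindowCount.Negative

open Summit.ABC.ABC.Theses.TwistAmplification WeierstrassCurve IsDedekindDomain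

noncomputable section



/-! ### 4.1 The polynomial model and its invariants -/

/-- `[1, r, 0, t] • ⟨1, 4β − α, 0, −(4α−1)β, 0⟩` written out: the general `u = 1`, `s = 0` translate of
B–G's model (12.18) of `y² = x(x − A)(x + B)` with `A = 4α − 1`, `B = 16β`. [folklore] -/
def fm (α β r t : ℤ) : WeierstrassCurve ℤ :=
  ⟨1, 4 * β - α + 3 * r, r + 2 * t,
    -((4 * α - 1) * β) + 2 * r * (4 * β - α) - t + 3 * r ^ 2,
    -(r * ((4 * α - 1) * β)) + r ^ 2 * (4 * β - α) + r ^ 3 - t ^ 2 - r * t⟩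

/-- `c₄` of the polynomial model `fm`: `A² + AB + B²` with `A = 4α − 1`, `B = 16β`. [folklore] -/
theorem fm_c₄ (α β r t : ℤ) :
    (fm α β r t).c₄ = (4 * α - 1) ^ 2 + (4 * α - 1) * (16 * β) + (16 * β) ^ 2 := by
  simp only [fm, WeierstrassCurve.c₄, WeierstrassCurve.b₂, WeierstrassCurve.b₄]; ring

/-- `c₆` of the polynomial model `fm`: `−(B−A)(2A+B)(A+2B)/2` written out. [folklore] -/
theorem fm_c₆ (α β r t : ℤ) :
    (fm α β r t).c₆ = -((16 * β - (4 * α - 1)) * ((4 * α - 1) + 8 * β) * ((4 * α - 1) + 32 * β)) := by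
  simp only [fm, WeierstrassCurve.c₆, WeierstrassCurve.b₂, WeierstrassCurve.b₄, WeierstrassCurve.b₆]; ring

/-- `Δ` of the polynomial model `fm`: `(AB/16)² (A+B)²`. [folklore] -/
theorem fm_Δ (α β r t : ℤ) :
    (fm α β r t).Δ = ((4 * α - 1) * β) ^ 2 * ((4 * α - 1) + 16 * β) ^ 2 := by
  simp only [fm, WeierstrassCurve.Δ, WeierstrassCurve.b₂, WeierstrassCurve.b₄, WeierstrassCurve.b₆,
    WeierstrassCurve.b₈]; ring

/-- Reduction parameters: `r` with `a₂ + 3r ∈ {−1,0,1}`, then `t` with `r + 2t ∈ {0,1}`. [folklore] -/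
def redR (a : ℤ) : ℤ := -((a + 1) / 3)

/-- Reduction parameter `t` with `r + 2t ∈ {0,1}`. [folklore] -/
def redT (r : ℤ) : ℤ := -(r / 2)

/-- `a₂ + 3·redR a₂ ∈ {−1,0,1}`. [folklore] -/
theorem red_a₂ (a : ℤ) : a + 3 * redR a = -1 ∨ a + 3 * redR a = 0 ∨ a + 3 * redR a = 1 := by
  unfold redR; omega

/-- `r + 2·redT r ∈ {0,1}`. [folklore] -/
theorem red_a₃ (r : ℤ) : r + 2 * redT r = 0 ∨ r + 2 * redT r = 1 := by
  unfold redT; omega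

/-- **The family.** `tf α k`: reduced minimal model of the twist by `D = 4α − 1` of the Frey curve of
`1 + 16k = q` (so `β = Dk`, `B = 16Dk = D(q−1)`). [folklore] -/
def tf (α k : ℤ) : WeierstrassCurve ℤ :=
  fm α ((4 * α - 1) * k) (redR (4 * ((4 * α - 1) * k) - α))
    (redT (redR (4 * ((4 * α - 1) * k) - α)))

/-- `a₁ (tf α k) = 1`. [folklore] -/
theorem tf_a₁ (α k : ℤ) : (tf α k).a₁ = 1 := rfl

/-- `tf α k` is reduced in `a₂`. [folklore] -/
theorem tf_a₂_mem (α k : ℤ) : (tf α k).a₂ = -1 ∨ (tf α k).a₂ = 0 ∨ (tf α k).a₂ = 1 :=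
  red_a₂ _

/-- `tf α k` is reduced in `a₃`. [folklore] -/
theorem tf_a₃_mem (α k : ℤ) : (tf α k).a₃ = 0 ∨ (tf α k).a₃ = 1 :=
  red_a₃ _

/-- `c₄ (tf α k) = D² (256k² + 16k + 1)`, `D = 4α − 1`. [folklore] -/
theorem tf_c₄ (α k : ℤ) : (tf α k).c₄ = (4 * α - 1) ^ 2 * (256 * k ^ 2 + 16 * k + 1) := by
  rw [tf, fm_c₄]; ring

/-- `Δ (tf α k) = D⁶ k² (16k+1)²`, `D = 4α − 1`. [folklore] -/
theorem tf_Δ (α k : ℤ) : (tf α k).Δ = (4 * α - 1) ^ 6 * k ^ 2 * (16 * k + 1) ^ 2 := by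
  rw [tf, fm_Δ]; ring

/-- `c₆ (tf α k) = −D³ (16k−1)(8k+1)(32k+1)`, `D = 4α − 1`. [folklore] -/
theorem tf_c₆ (α k : ℤ) :
    (tf α k).c₆ = -((4 * α - 1) ^ 3 * (16 * k - 1) * (8 * k + 1) * (32 * k + 1)) := by
  rw [tf, fm_c₆]; ring


/-! ### 4.2 Arithmetic of the family: ellipticity, minimality, exact conductor -/

section Arithmetic

variable {p j k d : ℕ} {α : ℤ}

/-- `m = 256k² + 16k + 1 = 16k(16k+1) + 1` is prime to `16k(16k+1)`. [folklore] -/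
theorem not_dvd_m_of_dvd_kq {ℓ : ℕ} (hℓ : ℓ.Prime) (h : (ℓ : ℤ) ∣ 16 * (k : ℤ) * (16 * k + 1)) :
    ¬ (ℓ : ℤ) ∣ 256 * (k : ℤ) ^ 2 + 16 * k + 1 := by
  intro hm
  have h1 : (ℓ : ℤ) ∣ 1 := by
    have e : (1 : ℤ) = (256 * (k : ℤ) ^ 2 + 16 * k + 1) - 16 * (k : ℤ) * (16 * k + 1) := by ring
    rw [e]; exact dvd_sub hm h
  have : (ℓ : ℤ) ∣ ((1 : ℕ) : ℤ) := by simpa using h1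
  have := Int.natCast_dvd_natCast.mp this
  exact hℓ.one_lt.ne' (Nat.dvd_one.mp this)

/-- `D² = d²` for `D = ±d`. [folklore] -/
theorem D_sq (hα : 4 * α - 1 = d ∨ 4 * α - 1 = -(d : ℤ)) : (4 * α - 1) ^ 2 = (d : ℤ) ^ 2 := by
  rcases hα with h | h
  · rw [h]
  · rw [h]; ring

/-- `D⁶ = d⁶` for `D = ±d`. [folklore] -/
theorem D_pow_six (hα : 4 * α - 1 = d ∨ 4 * α - 1 = -(d : ℤ)) : (4 * α - 1) ^ 6 = (d : ℤ) ^ 6 := by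
  rcases hα with h | h
  · rw [h]
  · rw [h]; ring

/-- `|D³| = d³` for `D = ±d`. [folklore] -/
theorem natAbs_D_pow_three (hα : 4 * α - 1 = d ∨ 4 * α - 1 = -(d : ℤ)) :
    ((4 * α - 1) ^ 3).natAbs = d ^ 3 := by
  rw [Int.natAbs_pow]
  rcases hα with h | h <;> (rw [h]; simp)

/-- `d ∣ D` for `D = ±d`. [folklore] -/
theorem d_dvd_D (hα : 4 * α - 1 = d ∨ 4 * α - 1 = -(d : ℤ)) : (d : ℤ) ∣ 4 * α - 1 := by
  rcases hα with h | h <;> rw [h]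
  exact (dvd_neg).mpr dvd_rfl

/-- `D ≠ 0` for `D = ±d`, `d` prime. [folklore] -/
theorem D_ne_zero (hd : d.Prime) (hα : 4 * α - 1 = d ∨ 4 * α - 1 = -(d : ℤ)) : 4 * α - 1 ≠ 0 := by
  have : (d : ℤ) ≠ 0 := by exact_mod_cast hd.ne_zero
  rcases hα with h | h <;> rw [h]
  · exact this
  · exact neg_ne_zero.mpr this

/-- A prime dividing `D = ±d` is `d`. [folklore] -/
theorem eq_d_of_prime_dvd_D (hd : d.Prime) (hα : 4 * α - 1 = d ∨ 4 * α - 1 = -(d : ℤ)) {ℓ : ℕ}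
    (hℓ : ℓ.Prime) (h : (ℓ : ℤ) ∣ 4 * α - 1) : ℓ = d := by
  have h' : (ℓ : ℤ) ∣ (d : ℤ) := by
    rcases hα with e | e
    · rwa [e] at h
    · rw [e] at h; exact (dvd_neg).mp h
  exact (Nat.prime_dvd_prime_iff_eq hℓ hd).mp (Int.natCast_dvd_natCast.mp h')

/-- **Key coprimality.** A prime dividing both `Δ (tf α k) = D⁶ k² q²` and `c₄ (tf α k) = D² m` is `d`. [folklore] -/
theorem eq_d_of_dvd_Δ_of_dvd_c₄ (hd : d.Prime) (hα : 4 * α - 1 = d ∨ 4 * α - 1 = -(d : ℤ)) {ℓ : ℕ}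
    (hℓ : ℓ.Prime) (hΔ : (ℓ : ℤ) ∣ (tf α (k : ℤ)).Δ) (hc₄ : (ℓ : ℤ) ∣ (tf α (k : ℤ)).c₄) : ℓ = d := by
  have hℓZ : Prime (ℓ : ℤ) := Nat.prime_iff_prime_int.mp hℓ
  rw [tf_c₄] at hc₄
  rw [tf_Δ] at hΔ
  rcases hℓZ.dvd_or_dvd hc₄ with h | h
  · exact eq_d_of_prime_dvd_D hd hα hℓ (hℓZ.dvd_of_dvd_pow h)
  · rcases hℓZ.dvd_or_dvd hΔ with h1 | h1
    · rcases hℓZ.dvd_or_dvd h1 with h2 | h2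
      · exact eq_d_of_prime_dvd_D hd hα hℓ (hℓZ.dvd_of_dvd_pow h2)
      · exact absurd h (not_dvd_m_of_dvd_kq hℓ
          (dvd_mul_of_dvd_left (dvd_mul_of_dvd_right (hℓZ.dvd_of_dvd_pow h2) _) _))
    · exact absurd h (not_dvd_m_of_dvd_kq hℓ (dvd_mul_of_dvd_right (hℓZ.dvd_of_dvd_pow h1) _))

/-- `d¹² ∤ Δ (tf α k)` when `d ∤ k` and `d ≠ p` (`q = p^j`). [folklore] -/
theorem not_d_pow_twelve_dvd_Δ (hp : p.Prime) (hq : (p : ℤ) ^ j = 16 * k + 1)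
    (hd : d.Prime) (hdp : d ≠ p) (hdk : ¬ d ∣ k) (hα : 4 * α - 1 = d ∨ 4 * α - 1 = -(d : ℤ)) :
    ¬ ((d : ℕ) : ℤ) ^ 12 ∣ (tf α (k : ℤ)).Δ := by
  rw [tf_Δ, D_pow_six hα, ← hq]
  intro h
  have hdZ : Prime (d : ℤ) := Nat.prime_iff_prime_int.mp hd
  have h' : (d : ℤ) ^ 6 * (d : ℤ) ^ 6 ∣ (d : ℤ) ^ 6 * ((k : ℤ) ^ 2 * ((p : ℤ) ^ j) ^ 2) := by
    have e1 : (d : ℤ) ^ 12 = (d : ℤ) ^ 6 * (d : ℤ) ^ 6 := by ring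
    have e2 : (d : ℤ) ^ 6 * (k : ℤ) ^ 2 * ((p : ℤ) ^ j) ^ 2 = (d : ℤ) ^ 6 * ((k : ℤ) ^ 2 * ((p : ℤ) ^ j) ^ 2) := by
      ring
    rwa [e1, e2] at h
  have hd0 : (d : ℤ) ^ 6 ≠ 0 := pow_ne_zero _ (by exact_mod_cast hd.ne_zero)
  have h6 : (d : ℤ) ^ 6 ∣ (k : ℤ) ^ 2 * ((p : ℤ) ^ j) ^ 2 := (mul_dvd_mul_iff_left hd0).mp h'
  have h1 : (d : ℤ) ∣ (k : ℤ) ^ 2 * ((p : ℤ) ^ j) ^ 2 := dvd_trans (dvd_pow_self _ (by norm_num)) h6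
  rcases hdZ.dvd_or_dvd h1 with h2 | h2
  · exact hdk (Int.natCast_dvd_natCast.mp (hdZ.dvd_of_dvd_pow h2))
  · have h3 : (d : ℤ) ∣ (p : ℤ) := hdZ.dvd_of_dvd_pow (hdZ.dvd_of_dvd_pow h2)
    exact hdp ((Nat.prime_dvd_prime_iff_eq hd hp).mp (Int.natCast_dvd_natCast.mp h3))

/-- `Δ (tf α k) ≠ 0`. [folklore] -/
theorem tf_Δ_ne_zero (hk : k ≠ 0) (hd : d.Prime) (hα : 4 * α - 1 = d ∨ 4 * α - 1 = -(d : ℤ)) :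
    (tf α (k : ℤ)).Δ ≠ 0 := by
  rw [tf_Δ]
  have h1 := D_ne_zero hd hα
  have h2 : (k : ℤ) ≠ 0 := by exact_mod_cast hk
  have h3 : (16 * (k : ℤ) + 1) ≠ 0 := by positivity
  positivity

/-- `tf α k ⊗ ℚ` is an elliptic curve. [folklore] -/
theorem tf_isElliptic (hk : k ≠ 0) (hd : d.Prime) (hα : 4 * α - 1 = d ∨ 4 * α - 1 = -(d : ℤ)) :
    ((tf α (k : ℤ)).baseChange ℚ).IsElliptic :=
  ⟨by rw [baseChange_int_Δ, isUnit_iff_ne_zero]; exact_mod_cast tf_Δ_ne_zero hk hd hα⟩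

/-- **Minimality at every place.** [folklore] -/
theorem tf_isMinimalAt (hp : p.Prime) (hq : (p : ℤ) ^ j = 16 * k + 1)
    (hd : d.Prime) (hdp : d ≠ p) (hdk : ¬ d ∣ k) (hα : 4 * α - 1 = d ∨ 4 * α - 1 = -(d : ℤ))
    (v : HeightOneSpectrum ℤ) : ((tf α (k : ℤ)).baseChange ℚ).IsMinimalAt v := by
  set ℓ := Rat.HeightOneSpectrum.natGenerator v with hℓ
  have hℓp : ℓ.Prime := Rat.HeightOneSpectrum.prime_natGenerator v
  by_cases h1 : (ℓ : ℤ) ∣ (tf α (k : ℤ)).c₄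
  · by_cases h2 : (ℓ : ℤ) ∣ (tf α (k : ℤ)).Δ
    · have hℓd : ℓ = d := eq_d_of_dvd_Δ_of_dvd_c₄ hd hα hℓp h2 h1
      apply isMinimalAt_baseChange_int_of_not_pow_dvd_Δ
      rw [← hℓ, hℓd]
      exact not_d_pow_twelve_dvd_Δ hp hq hd hdp hdk hα
    · apply isMinimalAt_baseChange_int_of_not_pow_dvd_Δ
      rw [← hℓ]
      exact fun h => h2 (dvd_trans (dvd_pow_self _ (by norm_num)) h)
  · exact isMinimalAt_baseChange_int_of_not_dvd_c₄ (by rwa [← hℓ])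

/-- The local conductor exponents of `tf α k`: `2` at `d`, `1` at `p` and at the primes of `k`,
`0` elsewhere. [folklore] -/
theorem tf_conductorExponent (hp : p.Prime) (hj : j ≠ 0) (hq : (p : ℤ) ^ j = 16 * k + 1) (hk : k ≠ 0)
    (hd : d.Prime) (h5 : 5 ≤ d) (hdp : d ≠ p) (hdk : ¬ d ∣ k) (hα : 4 * α - 1 = d ∨ 4 * α - 1 = -(d : ℤ))
    (ℓ : Nat.Primes) :
    haveI := tf_isElliptic hk hd hα
    ((tf α (k : ℤ)).baseChange ℚ).conductorExponent ((Rat.HeightOneSpectrum.primesEquiv (R := ℤ)).symm ℓ) =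
      if (ℓ : ℕ) = d then 2 else if (ℓ : ℕ) = p then 1 else if (ℓ : ℕ) ∣ k then 1 else 0 := by
  haveI := tf_isElliptic hk hd hα
  set v := (Rat.HeightOneSpectrum.primesEquiv (R := ℤ)).symm ℓ with hv
  have hgen : Rat.HeightOneSpectrum.natGenerator v = ℓ :=
    Literature.NumberTheory.EllipticCurves.Rat.natGenerator_primesEquiv_symm ℓ
  have hℓp : (ℓ : ℕ).Prime := ℓ.2
  have hℓZ : Prime ((ℓ : ℕ) : ℤ) := Nat.prime_iff_prime_int.mp hℓp
  have hmin := tf_isMinimalAt hp hq hd hdp hdk hα v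
  have hΔ : (tf α (k : ℤ)).Δ = (4 * α - 1) ^ 6 * (k : ℤ) ^ 2 * ((p : ℤ) ^ j) ^ 2 := by rw [tf_Δ, hq]
  split_ifs with h_d h_p h_k
  · -- `ℓ = d`: additive, `f = 2`
    refine le_antisymm ?_ ?_
    · exact conductorExponent_le_two_of_five_le_natGenerator_holds _ v (by rw [hgen, h_d]; exact h5)
    · apply two_le_conductorExponent_of_dvd_Δ_of_dvd_c₄ hmin
      · rw [hgen, h_d, tf_Δ]
        exact dvd_mul_of_dvd_left (dvd_mul_of_dvd_left (dvd_pow (d_dvd_D hα) (by norm_num)) _) _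
      · rw [hgen, h_d, tf_c₄]
        exact dvd_mul_of_dvd_left (dvd_pow (d_dvd_D hα) (by norm_num)) _
  · -- `ℓ = p`: multiplicative
    apply conductorExponent_eq_one_of_dvd_Δ_of_not_dvd_c₄ hmin
    · rw [hgen, h_p, hΔ]
      exact dvd_mul_of_dvd_right (dvd_pow (dvd_pow_self _ hj) (by norm_num)) _
    · rw [hgen]
      intro hc
      have hΔ' : ((ℓ : ℕ) : ℤ) ∣ (tf α (k : ℤ)).Δ := by
        rw [h_p, hΔ]; exact dvd_mul_of_dvd_right (dvd_pow (dvd_pow_self _ hj) (by norm_num)) _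
      exact hdp ((eq_d_of_dvd_Δ_of_dvd_c₄ hd hα hℓp hΔ' hc).symm.trans h_p)
  · -- `ℓ ∣ k`, `ℓ ≠ d`: multiplicative
    apply conductorExponent_eq_one_of_dvd_Δ_of_not_dvd_c₄ hmin
    · rw [hgen, tf_Δ]
      exact dvd_mul_of_dvd_left (dvd_mul_of_dvd_right
        (dvd_pow (Int.natCast_dvd_natCast.mpr h_k) (by norm_num)) _) _
    · rw [hgen]
      intro hc
      have hΔ' : ((ℓ : ℕ) : ℤ) ∣ (tf α (k : ℤ)).Δ := by
        rw [tf_Δ]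
        exact dvd_mul_of_dvd_left (dvd_mul_of_dvd_right
          (dvd_pow (Int.natCast_dvd_natCast.mpr h_k) (by norm_num)) _) _
      exact h_d (eq_d_of_dvd_Δ_of_dvd_c₄ hd hα hℓp hΔ' hc)
  · -- good reduction
    apply conductorExponent_eq_zero_of_not_dvd_Δ hmin
    rw [hgen, hΔ]
    intro h
    rcases hℓZ.dvd_or_dvd h with h1 | h1
    · rcases hℓZ.dvd_or_dvd h1 with h2 | h2
      · exact h_d (eq_d_of_prime_dvd_D hd hα hℓp (hℓZ.dvd_of_dvd_pow h2))
      · exact h_k (Int.natCast_dvd_natCast.mp (hℓZ.dvd_of_dvd_pow h2))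
    · have : ((ℓ : ℕ) : ℤ) ∣ (p : ℤ) := hℓZ.dvd_of_dvd_pow (hℓZ.dvd_of_dvd_pow h1)
      exact h_p ((Nat.prime_dvd_prime_iff_eq hℓp hp).mp (Int.natCast_dvd_natCast.mp this))

/-- `p ∤ k` (as `p ∣ 16k + 1`). [folklore] -/
theorem not_p_dvd_k (hp : p.Prime) (hj : j ≠ 0) (hq : (p : ℤ) ^ j = 16 * k + 1) : ¬ p ∣ k := by
  intro h
  have h1 : (p : ℤ) ∣ 16 * k + 1 := by rw [← hq]; exact dvd_pow_self _ hj
  have h2 : (p : ℤ) ∣ 16 * (k : ℤ) := dvd_mul_of_dvd_right (Int.natCast_dvd_natCast.mpr h) _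
  have h3 : (p : ℤ) ∣ 1 := by
    have e : (1 : ℤ) = (16 * k + 1) - 16 * k := by ring
    rw [e]; exact dvd_sub h1 h2
  have : (p : ℤ) ∣ ((1 : ℕ) : ℤ) := by simpa using h3
  exact hp.one_lt.ne' (Nat.dvd_one.mp (Int.natCast_dvd_natCast.mp this))

/-- **The conductor of `tf α k` is exactly `d² · p · rad k`.** [folklore] -/
theorem tf_conductorNorm (hp : p.Prime) (hj : j ≠ 0) (hq : (p : ℤ) ^ j = 16 * k + 1) (hk : k ≠ 0)
    (hd : d.Prime) (h5 : 5 ≤ d) (hdp : d ≠ p) (hdk : ¬ d ∣ k) (hα : 4 * α - 1 = d ∨ 4 * α - 1 = -(d : ℤ)) :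
    haveI := tf_isElliptic hk hd hα
    ((tf α (k : ℤ)).baseChange ℚ).conductorNorm ℤ = d ^ 2 * (p * UniqueFactorizationMonoid.radical k) := by
  haveI := tf_isElliptic hk hd hα
  have hN0 : ((tf α (k : ℤ)).baseChange ℚ).conductorNorm ℤ ≠ 0 := (conductorNorm_pos_holds _).ne'
  have hrad0 : UniqueFactorizationMonoid.radical k ≠ 0 := UniqueFactorizationMonoid.radical_ne_zero
  have hB0 : d ^ 2 * (p * UniqueFactorizationMonoid.radical k) ≠ 0 :=
    mul_ne_zero (pow_ne_zero _ hd.ne_zero) (mul_ne_zero hp.ne_zero hrad0)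
  have hpk := not_p_dvd_k hp hj hq
  apply Nat.eq_of_factorization_eq hN0 hB0
  intro ℓ
  by_cases hℓ : ℓ.Prime
  · rw [factorization_conductorNorm_primesEquiv_symm _ ⟨ℓ, hℓ⟩,
      tf_conductorExponent hp hj hq hk hd h5 hdp hdk hα ⟨ℓ, hℓ⟩]
    simp only
    rw [Nat.factorization_mul (pow_ne_zero _ hd.ne_zero) (mul_ne_zero hp.ne_zero hrad0),
      Nat.factorization_mul hp.ne_zero hrad0, Nat.factorization_pow, hd.factorization, hp.factorization]
    simp only [Finsupp.coe_add, Pi.add_apply, Finsupp.smul_apply, Finsupp.single_apply, smul_eq_mul]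
    rw [Literature.NumberTheory.DiophantineGeometry.factorization_radical_apply hk hℓ]
    by_cases h_d : ℓ = d
    · subst h_d
      have h2 : p ≠ ℓ := fun h => hdp h.symm
      simp [h2, hdk]
    · by_cases h_p : ℓ = p
      · have h1 : d ≠ ℓ := fun h => h_d h.symm
        have hℓk : ¬ ℓ ∣ k := h_p ▸ hpk
        simp [h_d, h1, h_p.symm, hℓk]
      · have h1 : d ≠ ℓ := fun h => h_d h.symm
        have h2 : p ≠ ℓ := fun h => h_p h.symm
        by_cases h_k : ℓ ∣ k
        · simp [h1, h2, h_k, h_d, h_p]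
        · simp [h1, h2, h_k, h_d, h_p]
  · rw [Nat.factorization_eq_zero_of_not_prime _ hℓ, Nat.factorization_eq_zero_of_not_prime _ hℓ]

end Arithmetic

end

end Summit.ABC.ABC.Theorems.ModerateWindowCount.Negative
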